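import Summits.BirchSwinnertonDyer.BirchSwinnertonDyer.Theorems.ManinLocalTwoThreeBracketSturmNinetyNineB
import Summits.BirchSwinnertonDyer.BirchSwinnertonDyer.Theorems.ManinLocalTwoThreeBracketSturmNinetyNineC
import Summits.BirchSwinnertonDyer.BirchSwinnertonDyer.Theorems.ManinLocalTwoThreeBracketSturmNinetyNineD
import Summits.BirchSwinnertonDyer.BirchSwinnertonDyer.Theorems.EdixhovenFibreFiveSevenTwistDegreeStepFiveSevenLTwistCore
import Literature.NumberTheory.EllipticCurves.NewformsOldNewProofs
import HarnessLib

/-!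
# LEVEL 99 = 9·11 COMPLETE (C3, `9 ∥ 99`): `|c| = 1 ∧ 3 ∤ c` for EVERY lattice-optimal `X₀(99)`-datum of EVERY globally minimal
# elliptic curve over `ℚ` — unconditional, no printed fact, no UDC term

Cell `bsd-f2-manin`, route `ManinLocalTwoThree`, crux C3 `ManinPrimeToThreeAtNine` (stmt-BirchSwinnertonDyer-22968); prover seat p3 gen 28;
`--supports` (helper).  ASSEMBLY of an g59's pinning `…PinningNinetyNine.pinning_cusp` (every datum's newform is one of SIX certified rows
on the twist-closure basis of `S₂(Γ₀(99))`) with this seat's four Bracket–Sturm certificates (`…BracketSturmNinetyNine{A,B,C,D}`: `99a`, `99d` at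
weight 2, depth 146; `99b`, `99c` at weight 4 on the 40 products of p3 g27's `η`-quotients, depth 242) and the DISMISSAL OF THE TWO GHOST ROWS.

THE GHOSTS.  Rows `rowO11` (`D.f = h0 + h1 + 3h2`) and `rowO33` (`D.f = h0 + 4h1 + 3h2 + 3h3 + 3h4`) are the `3`-depleted coefficient systems of
the old classes `11a`, `33a`: consistent with every linear relation of `S₂(Γ₀(99))`, invisible to the sieve.  They are excluded HERE, fact-free:
the five seeds `h0,…,h4` are OLDFORMS — `h0 = ι₁φ₁₁`, `3h1 = ι₃φ₁₁`, `9h2 = ι₉φ₁₁` (`φ₁₁ = η₁²η₁₁²` on `Γ₀(11)`), `h3 = ι₁g₃₃`, `3h4 = ι₃g₃₃`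
(`g₃₃ = η₁η₃η₁₁η₃₃` on `Γ₀(33)`), each an identity of cusp forms of level `99` proved by Sturm (`48 > 24` coefficients, the tree's
`cuspCoeff_degeneracyMap0`) — so a ghost row puts `D.f` in `oldSubspace0 99 2`; but `D.f ∈ newSubspace0 99 2` (`IsNewform0`), and
`oldSubspace0 ⊓ newSubspace0 = ⊥` is the TREE THEOREM `disjoint_oldSubspace0_newSubspace0_holds` (Atkin–Lehner, proved in
`Literature/…/NewformsOldNewProofs`), whence `D.f = 0`, contradicting `a₁(D.f) = 1`.

RESULT: `abs_maninConstant_eq_one_ninetyNine`, `not_three_dvd_maninConstant_ninetyNine`, `maninPrimeToThreeAtNine_ninetyNine` (the C3 shape on the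
whole `X₀(99)`-domain).  UNCONDITIONAL (standard axioms); no named fact; independent of the in-tree UDC term (a CDT-free certificate of the closed
crux C3 at this level).  Nothing here proves C3 for general `N`, Manin's conjecture or BSD.
[cite: CremonaAlgorithms1997, §2.10, Table 1 (99a, 99b, 99c, 99d)] [cite: AtkinLehner1970, Thm. 5] [cite: DiamondShurman2005, §5.7 p. 211]
[cite: Sturm1987, Thm. 1] [cite: Manin1972, Prop. 1.4] [cite: AgasheRibetStein2006, §§1–2]
-/

set_option autoImplicit false
-- lint-debt: the directory name repeats the summit name (sibling precedent `ManinLocalTwoThreeRootSqueezeElevenNinetyNine.lean`)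
set_option linter.dupNamespace false

noncomputable section

open Complex
open UpperHalfPlane hiding I
open scoped MatrixGroups ModularForm
open ModularForm CongruenceSubgroup PowerSeries
open Literature.NumberTheory.ModularForms
open Literature.NumberTheory.EllipticCurves Literature.NumberTheory.EllipticCurves.ModularForms

namespace Summit.BirchSwinnertonDyer.BirchSwinnertonDyer.Theorems.ManinLocalTwoThree.LevelNinetyNine

open Summit.BirchSwinnertonDyer.BirchSwinnertonDyer.Theorems.ManinLocalTwoThree.BracketSturm
open Summit.BirchSwinnertonDyer.BirchSwinnertonDyer.Theorems.ManinLocalTwoThree.PinningKernel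
open Summit.BirchSwinnertonDyer.BirchSwinnertonDyer.Theorems.ManinLocalTwoThree.PinningNinetyNine
open Summit.BirchSwinnertonDyer.BirchSwinnertonDyer.Theorems.ManinLocalTwoThree.RootSqueezeEleven
open Summit.BirchSwinnertonDyer.BirchSwinnertonDyer.Theorems.ManinLocalTwoThree.RootSqueezeElevenNinetyNine
open Summit.BirchSwinnertonDyer.BirchSwinnertonDyer.Theorems.LTwist (cuspCoeff_degeneracyMap0)

set_option maxHeartbeats 4000000
set_option maxRecDepth 16384

/-! ## §1 A Sturm lemma at level `99`, weight `2` -/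

/-- Two cusp forms of level `99`, weight `2`, with the same first `48` coefficients are equal (Sturm: `⌊2·144/12⌋ = 24 < 48`).
[cite: Sturm1987, Thm. 1] -/
theorem cuspForm_eq_of_cuspCoeff_eq {F G : CuspForm (Gamma0 99) 2} (h : ∀ n < 48, cuspCoeff F n = cuspCoeff G n) : F = G := by
  rw [← sub_eq_zero]
  apply cuspForm_eq_of_modularForm_eq
  have h0 : ModularFormClass.modularForm (F - G) = 0 := by
    refine modularForm_eq_zero_of_coeff_eq_zero (N := 99) _ (m := 48) (fun n hn ↦ ?_) (by rw [gamma0_data.1]; decide)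
    rw [← modCoefₗ_apply (N := 99) (k := 2), modCoefₗ_modularForm,
      ← cuspCoeffₗ_apply (one_mem_strictPeriods_coe_gamma0 99) n (F - G), map_sub, cuspCoeffₗ_apply, cuspCoeffₗ_apply, h n hn, sub_self]
  rw [h0]
  refine DFunLike.ext' ?_
  change ((0 : ModularForm (Gamma0 99) 2) : ℍ → ℂ) = ⇑(0 : CuspForm (Gamma0 99) 2)
  rw [ModularForm.coe_zero, CuspForm.coe_zero]

/-! ## §2 The level-`33` seed `g₃₃ = η₁η₃η₁₁η₃₃` and the decidable coefficient identities -/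

/-- The cuspidal `η`-quotient `g₃₃ = η₁η₃η₁₁η₃₃` of level `33` (Newman witness `33`). [cite: Koehler2011, §2.1] -/
def Ls33 : List (List (ℕ × ℤ) × ℕ) := [([(1, 1), (3, 1), (11, 1), (33, 1)], 33)]

/-- Newman / Ligozat conditions of `g₃₃` on `Γ₀(33)` (cuspidal). [cite: Koehler2011, §2.1] [cite: Ligozat1975, Ch. 3] -/
theorem hcusp33 : ∀ p ∈ Ls33, (∑ δ ∈ (33 : ℕ).divisors, expFn p.1 δ = 4) ∧
    ((24 : ℤ) ∣ ∑ δ ∈ (33 : ℕ).divisors, (δ : ℤ) * expFn p.1 δ) ∧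
    ((24 : ℤ) ∣ ∑ δ ∈ (33 : ℕ).divisors, ((33 / δ : ℕ) : ℤ) * expFn p.1 δ) ∧
    (p.2 * p.2 = ∏ δ ∈ (33 : ℕ).divisors, δ ^ (expFn p.1 δ).natAbs) ∧
    (∀ c ∈ (33 : ℕ).divisors, 0 < cuspOrder24 33 (expFn p.1) c) := by
  decide +kernel

/-- The table of `g₃₃` to depth `48`. [cite: Koehler2011, §2.1] -/
def tab33 : Fin 1 → List ℤ :=
  ![[0, 0, 1, -1, -1, -1, 1, 2, -1, 2, 0, 0, -1, -2, 0, 0, 1, 0, -3, 0, 0, 0, 1, 3, 1, 1, 2, 0, 0, -2, 2, -5, -1, -1, -2, -2, 3, 1, 0, -2, 2, 2, -4, 2, -1, 1, 2, 0]]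

/-- The `q`-shift of `g₃₃` is `2`. [folklore] -/
theorem hshift33 : ∀ i : Fin 1, ∑ δ ∈ (33 : ℕ).divisors, (δ : ℤ) * expFn (Ls33[(i : ℕ)]).1 δ = 24 * ((![2] : Fin 1 → ℕ) i : ℕ) := by
  decide +kernel

/-- Sparse `η` certificate of `g₃₃` at depth `48` (kernel `decide`). [cite: Koehler2011, §2.1] -/
theorem hcert33 : ∀ i : Fin 1, mulList 48 (tab33 i) (etaDenListSparse 48 33 (expFn (Ls33[(i : ℕ)]).1)) =
    etaNumListSparse 48 33 (expFn (Ls33[(i : ℕ)]).1) ((![2] : Fin 1 → ℕ) i) := by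
  decide +kernel

/-- `h0 = ι₁φ₁₁` on tables. [folklore] -/
theorem hI0 : ∀ n < 48, (stabs 0).getD n 0 = cF242.getD n 0 := by decide +kernel
/-- `3h1 = ι₃φ₁₁` on tables. [folklore] -/
theorem hI1 : ∀ n < 48, 3 * (stabs 1).getD n 0 = 3 * (if 3 ∣ n then cF242.getD (n / 3) 0 else 0) := by decide +kernel
/-- `9h2 = ι₉φ₁₁` on tables. [folklore] -/
theorem hI2 : ∀ n < 48, 9 * (stabs 2).getD n 0 = 9 * (if 9 ∣ n then cF242.getD (n / 9) 0 else 0) := by decide +kernel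
/-- `h3 = ι₁g₃₃` on tables. [folklore] -/
theorem hI3 : ∀ n < 48, (stabs 3).getD n 0 = (tab33 0).getD n 0 := by decide +kernel
/-- `3h4 = ι₃g₃₃` on tables. [folklore] -/
theorem hI4 : ∀ n < 48, 3 * (stabs 4).getD n 0 = 3 * (if 3 ∣ n then (tab33 0).getD (n / 3) 0 else 0) := by decide +kernel

/-! ## §3 The five seeds `h0,…,h4` are oldforms of level `99` -/

section Old

variable (S : Fin 6 → CuspForm (Gamma0 99) 2) (hS : ∀ i, ∀ τ : ℍ, S i τ = etaQuotient 99 (expFn (Ls[(i : ℕ)]).1) τ)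
include hS

/-- **The seeds `h0, h1, h2, h3, h4` of `pinning_cusp` lie in `oldSubspace0 99 2`**: `h0 = ι₁φ₁₁`, `3h1 = ι₃φ₁₁`, `9h2 = ι₉φ₁₁`, `h3 = ι₁g₃₃`,
`3h4 = ι₃g₃₃` as cusp forms of level `99` (Sturm from the certified tables and `cuspCoeff_degeneracyMap0`).
[cite: DiamondShurman2005, §5.7 p. 211] [cite: Sturm1987, Thm. 1] [cite: AtkinLehner1970, §2] -/
theorem seeds_mem_oldSubspace0 :
    S 0 ∈ oldSubspace0 99 2 ∧ S 1 ∈ oldSubspace0 99 2 ∧ S 2 ∈ oldSubspace0 99 2 ∧ S 3 ∈ oldSubspace0 99 2 ∧ S 4 ∈ oldSubspace0 99 2 := by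
  have hs := stabs_eq_cuspCoeff S hS
  -- `φ₁₁` and its table
  have hphi : ∀ n < 242, ((cF242.getD n 0 : ℤ) : ℂ) = cuspCoeff cuspFormEtaProductEleven n := fun n hn ↦
    qExpansion_coeff_eq_of_etaCertificateSparse_cuspForm cuspFormEtaProductEleven (expFn [(1, 2), (11, 2)])
      PinningOneSeventySix.phi11_eq_etaQuotient 1 PinningOneSeventySix.hS.1 cF242 hcertPhi11_242 n hn
  -- `g₃₃` and its table
  obtain ⟨T, hT⟩ : ∃ T : Fin 1 → CuspForm (Gamma0 33) 2, ∀ i, ∀ τ : ℍ, T i τ = etaQuotient 33 (expFn (Ls33[(i : ℕ)]).1) τ :=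
    exists_etaCuspForms 33 Ls33 hcusp33
  obtain ⟨CT, hCT⟩ : ∃ CT : Fin 1 → ModularForm (Gamma0 33) 2, ∀ i, ModularFormClass.modularForm (T i) = CT i := ⟨_, fun _ ↦ rfl⟩
  have hCT' : ∀ i, ∀ τ : ℍ, CT i τ = etaQuotient 33 (expFn (Ls33[(i : ℕ)]).1) τ := fun i τ ↦ by rw [← hCT]; exact hT i τ
  have htT := tables_of_etaCertsSparse 33 48 (fun i : Fin 1 ↦ expFn (Ls33[(i : ℕ)]).1) (![2]) tab33 CT hCT' hshift33 hcert33
  have hg : ∀ m < 48, (((tab33 0).getD m 0 : ℤ) : ℂ) = cuspCoeff (T 0) m := fun m hm ↦ by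
    rw [← modCoefₗ_modularForm (T 0) m, hCT]; exact htT 0 m hm
  -- memberships of degeneracy images
  have hmem : ∀ (M d : ℕ) [NeZero M] [NeZero d] (hM : M ∈ (99 : ℕ).properDivisors) (hMd : M * d ∣ 99) (g : CuspForm (Gamma0 M) 2),
      degeneracyMap0 M 99 d 2 g ∈ oldSubspace0 99 2 := by
    intro M d _ _ hM hMd g
    exact Submodule.mem_iSup_of_mem (⟨(M, d), hM, hMd⟩ : DegeneracyIndex 99) (LinearMap.mem_range_self _ g)
  have h11 : (11 : ℕ) ∈ (99 : ℕ).properDivisors := by decide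
  have h33 : (33 : ℕ) ∈ (99 : ℕ).properDivisors := by decide
  -- coefficient casts
  have cast_ite : ∀ (d n : ℕ) (t : ℕ → ℤ), (((if d ∣ n then t (n / d) else 0 : ℤ)) : ℂ) = (if d ∣ n then ((t (n / d) : ℤ) : ℂ) else 0) := by
    intro d n t; split_ifs <;> simp
  refine ⟨?_, ?_, ?_, ?_, ?_⟩
  · -- h0 = ι₁ φ₁₁
    have he : S 0 = degeneracyMap0 11 99 1 2 cuspFormEtaProductEleven := cuspForm_eq_of_cuspCoeff_eq fun n hn ↦ by
      rw [cuspCoeff_degeneracyMap0_one (⟨9, rfl⟩ : 11 ∣ 99), ← hs 0 n hn, ← hphi n (by omega), hI0 n hn]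
    rw [he]; exact hmem 11 1 h11 (by norm_num) _
  · -- 3 h1 = ι₃ φ₁₁
    have he : (3 : ℂ) • S 1 = degeneracyMap0 11 99 3 2 cuspFormEtaProductEleven := cuspForm_eq_of_cuspCoeff_eq fun n hn ↦ by
      rw [cuspCoeff_degeneracyMap0 (by norm_num : 11 * 3 ∣ 99), ← cuspCoeffₗ_apply (one_mem_strictPeriods_coe_gamma0 99) n, map_smul,
        smul_eq_mul, cuspCoeffₗ_apply, ← hs 1 n hn, show ((2 : ℤ) - 1) = 1 by norm_num, zpow_one]
      have h3 := hI1 n hn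
      have hc : ((3 * (stabs 1).getD n 0 : ℤ) : ℂ) = ((3 * (if 3 ∣ n then cF242.getD (n / 3) 0 else 0) : ℤ) : ℂ) := by exact_mod_cast h3
      push_cast at hc
      rw [hc]
      split_ifs with hd
      · rw [hphi (n / 3) (by omega)]; push_cast; ring
      · simp
    have he' : S 1 = (3 : ℂ)⁻¹ • degeneracyMap0 11 99 3 2 cuspFormEtaProductEleven := by
      rw [← he, smul_smul, inv_mul_cancel₀ (by norm_num), one_smul]
    rw [he']; exact Submodule.smul_mem _ _ (hmem 11 3 h11 (by norm_num) _)
  · -- 9 h2 = ι₉ φ₁₁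
    have he : (9 : ℂ) • S 2 = degeneracyMap0 11 99 9 2 cuspFormEtaProductEleven := cuspForm_eq_of_cuspCoeff_eq fun n hn ↦ by
      rw [cuspCoeff_degeneracyMap0 (by norm_num : 11 * 9 ∣ 99), ← cuspCoeffₗ_apply (one_mem_strictPeriods_coe_gamma0 99) n, map_smul,
        smul_eq_mul, cuspCoeffₗ_apply, ← hs 2 n hn, show ((2 : ℤ) - 1) = 1 by norm_num, zpow_one]
      have h9 := hI2 n hn
      have hc : ((9 * (stabs 2).getD n 0 : ℤ) : ℂ) = ((9 * (if 9 ∣ n then cF242.getD (n / 9) 0 else 0) : ℤ) : ℂ) := by exact_mod_cast h9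
      push_cast at hc
      rw [hc]
      split_ifs with hd
      · rw [hphi (n / 9) (by omega)]; push_cast; ring
      · simp
    have he' : S 2 = (9 : ℂ)⁻¹ • degeneracyMap0 11 99 9 2 cuspFormEtaProductEleven := by
      rw [← he, smul_smul, inv_mul_cancel₀ (by norm_num), one_smul]
    rw [he']; exact Submodule.smul_mem _ _ (hmem 11 9 h11 (by norm_num) _)
  · -- h3 = ι₁ g₃₃
    have he : S 3 = degeneracyMap0 33 99 1 2 (T 0) := cuspForm_eq_of_cuspCoeff_eq fun n hn ↦ by
      rw [cuspCoeff_degeneracyMap0_one (⟨3, rfl⟩ : 33 ∣ 99), ← hs 3 n hn, ← hg n hn, hI3 n hn]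
    rw [he]; exact hmem 33 1 h33 (by norm_num) _
  · -- 3 h4 = ι₃ g₃₃
    have he : (3 : ℂ) • S 4 = degeneracyMap0 33 99 3 2 (T 0) := cuspForm_eq_of_cuspCoeff_eq fun n hn ↦ by
      rw [cuspCoeff_degeneracyMap0 (by norm_num : 33 * 3 ∣ 99), ← cuspCoeffₗ_apply (one_mem_strictPeriods_coe_gamma0 99) n, map_smul,
        smul_eq_mul, cuspCoeffₗ_apply, ← hs 4 n hn, show ((2 : ℤ) - 1) = 1 by norm_num, zpow_one]
      have h3 := hI4 n hn
      have hc : ((3 * (stabs 4).getD n 0 : ℤ) : ℂ) = ((3 * (if 3 ∣ n then (tab33 0).getD (n / 3) 0 else 0) : ℤ) : ℂ) := by exact_mod_cast h3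
      push_cast at hc
      rw [hc]
      split_ifs with hd
      · rw [hg (n / 3) (by omega)]; push_cast; ring
      · simp
    have he' : S 4 = (3 : ℂ)⁻¹ • degeneracyMap0 33 99 3 2 (T 0) := by
      rw [← he, smul_smul, inv_mul_cancel₀ (by norm_num), one_smul]
    rw [he']; exact Submodule.smul_mem _ _ (hmem 33 3 h33 (by norm_num) _)

/-- **GHOST EXCLUSION.**  A pinning row supported on the old seeds `h0,…,h4` (coefficients of `h5, χ·h0, χ·h3, χ·h5` zero) is realised by NO
`X₀(99)`-datum: it would put the newform `D.f` in `oldSubspace0 ⊓ newSubspace0 = ⊥` (tree theorem `disjoint_oldSubspace0_newSubspace0_holds`),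
contradicting `a₁(D.f) = 1`. [cite: AtkinLehner1970, Thm. 5] -/
theorem no_datum_of_old_row {W : WeierstrassCurve ℚ} [W.IsElliptic] (D : ModularParametrizationData W 99) (y : List ℤ)
    (hy5 : y.getD 5 0 = 0) (hy6 : y.getD 6 0 = 0) (hy7 : y.getD 7 0 = 0) (hy8 : y.getD 8 0 = 0)
    (hpin : (((1 : ℤ) : ℤ) : ℂ) • D.f = ∑ j : Fin 9, ((y.getD (j : ℕ) 0 : ℤ) : ℂ) • basis S j) : False := by
  obtain ⟨h0, h1, h2, h3, h4⟩ := seeds_mem_oldSubspace0 S hS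
  rw [Int.cast_one, one_smul] at hpin
  have hold : D.f ∈ oldSubspace0 99 2 := by
    rw [hpin]
    refine Submodule.sum_mem _ fun j _ ↦ ?_
    fin_cases j
    · exact Submodule.smul_mem _ _ h0
    · exact Submodule.smul_mem _ _ h1
    · exact Submodule.smul_mem _ _ h2
    · exact Submodule.smul_mem _ _ h3
    · exact Submodule.smul_mem _ _ h4
    · show ((y.getD 5 0 : ℤ) : ℂ) • _ ∈ _
      rw [hy5, Int.cast_zero, zero_smul]; exact Submodule.zero_mem _
    · show ((y.getD 6 0 : ℤ) : ℂ) • _ ∈ _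
      rw [hy6, Int.cast_zero, zero_smul]; exact Submodule.zero_mem _
    · show ((y.getD 7 0 : ℤ) : ℂ) • _ ∈ _
      rw [hy7, Int.cast_zero, zero_smul]; exact Submodule.zero_mem _
    · show ((y.getD 8 0 : ℤ) : ℂ) • _ ∈ _
      rw [hy8, Int.cast_zero, zero_smul]; exact Submodule.zero_mem _
  have hnew : D.f ∈ newSubspace0 99 2 := D.isNewformOf.1.1
  have hdisj : Disjoint (oldSubspace0 99 2) (newSubspace0 99 2) := disjoint_oldSubspace0_newSubspace0_holds (N := 99) (k := 2)
  have hzero : D.f = 0 := (Submodule.disjoint_def.mp hdisj) _ hold hnew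
  have hnorm : (qExpansion 1 ⇑D.f).coeff 1 = 1 := D.isNewformOf.1.2.2
  rw [hzero, CuspForm.coe_zero, UpperHalfPlane.qExpansion_zero, map_zero] at hnorm
  exact zero_ne_one hnorm

end Old

/-! ## §4 LEVEL 99 COMPLETE -/

/-- **`|c| = 1 ∧ 3 ∤ c` FOR EVERY LATTICE-OPTIMAL `X₀(99)`-DATUM of every globally minimal elliptic curve over `ℚ`** — UNCONDITIONAL, fact-free,
UDC-free: an's six rows ↦ ghosts `11a⁰`, `33a⁰` excluded (§3); `99a`, `99d` ↦ weight-2 Bracket–Sturm; `99b`, `99c` ↦ weight-4 Bracket–Sturm.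
[cite: Manin1972, Prop. 1.4] [cite: AgasheRibetStein2006, §§1–2] [cite: CremonaAlgorithms1997, Table 1 (99a1, 99b1, 99c1, 99d1)] -/
theorem shapes_ninetyNine_all (W : WeierstrassCurve ℚ) [W.IsElliptic] [W.IsGloballyMinimal]
    (D : ModularParametrizationData W 99) (hopt : ∀ z ∈ D.L.lattice, ∃ w ∈ periodLattice D.f, z = D.c * w) :
    |D.maninConstant| = 1 ∧ ¬ (3 : ℤ) ∣ D.maninConstant := by
  obtain ⟨S, hS, c, hc, -, hpin⟩ := pinning_cusp D
  rw [certs_eq_rows] at hc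
  simp only [List.mem_cons, List.mem_nil_iff, or_false] at hc
  rcases hc with rfl | rfl | rfl | rfl | rfl | rfl
  · exact (no_datum_of_old_row S hS D rowO11.2.2 rfl rfl rfl rfl hpin).elim
  · exact shapes_A_of_coeff W D hopt (coeff_f_eq_of_pin S hS D yA cFa (by norm_num) hrowA hpin)
  · exact shapes_B_of_coeff W D hopt (coeff_f_eq_of_pin S hS D yB cFb le_rfl hrowB hpin)
  · exact (no_datum_of_old_row S hS D rowO33.2.2 rfl rfl rfl rfl hpin).elim
  · exact shapes_C_of_coeff W D hopt (coeff_f_eq_of_pin S hS D yC cFc le_rfl hrowC hpin)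
  · exact shapes_D_of_coeff W D hopt (coeff_f_eq_of_pin S hS D yD cFd (by norm_num) hrowD hpin)

/-- **`|c| = 1` for every lattice-optimal `X₀(99)`-datum** of every globally minimal elliptic curve over `ℚ`. UNCONDITIONAL.
[cite: Manin1972, Prop. 1.4] [cite: AgasheRibetStein2006, §§1–2] [cite: CremonaAlgorithms1997, Table 1 (99a–d)] -/
theorem abs_maninConstant_eq_one_ninetyNine (W : WeierstrassCurve ℚ) [W.IsElliptic] [W.IsGloballyMinimal]
    (D : ModularParametrizationData W 99) (hopt : ∀ z ∈ D.L.lattice, ∃ w ∈ periodLattice D.f, z = D.c * w) :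
    |D.maninConstant| = 1 :=
  (shapes_ninetyNine_all W D hopt).1

/-- **C3 `ManinPrimeToThreeAtNine` at `N = 99` (`3² ∣ 99`): `3 ∤ c(D)`** for every lattice-optimal `X₀(99)`-datum — UNCONDITIONAL.
[cite: AgasheRibetStein2006, §§1–2] -/
theorem not_three_dvd_maninConstant_ninetyNine (W : WeierstrassCurve ℚ) [W.IsElliptic] [W.IsGloballyMinimal]
    (D : ModularParametrizationData W 99) (hopt : ∀ z ∈ D.L.lattice, ∃ w ∈ periodLattice D.f, z = D.c * w) :
    ¬ (3 : ℤ) ∣ D.maninConstant :=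
  (shapes_ninetyNine_all W D hopt).2

/-- **The C3 conclusion on the whole `X₀(99)`-domain**: `3² ∣ 99`, and `|c| = 1 ∧ 3 ∤ c` for every lattice-optimal `X₀(99)`-datum of every
globally minimal elliptic curve over `ℚ` — UNCONDITIONAL, independent of the in-tree UDC term; BSD and C3 for general `N` are NOT proved by this.
[folklore] -/
theorem maninPrimeToThreeAtNine_ninetyNine :
    3 ^ 2 ∣ 99 ∧ ∀ (W : WeierstrassCurve ℚ) [W.IsElliptic] [W.IsGloballyMinimal] (D : ModularParametrizationData W 99),
      (∀ z ∈ D.L.lattice, ∃ w ∈ periodLattice D.f, z = D.c * w) → |D.maninConstant| = 1 ∧ ¬ (3 : ℤ) ∣ D.maninConstant :=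
  ⟨⟨11, by norm_num⟩, fun W _ _ D hopt ↦ shapes_ninetyNine_all W D hopt⟩

/-- **No `X₀(99)`-datum has the `3`-depleted signature of `11a` or `33a`**: `(a₂(W), a₅(W)) ∉ {(−2, 1), (1, −2)}` for every `X₀(99)`-datum of an
elliptic `W/ℚ` (the ghost rows of an's pinning are empty). [cite: AtkinLehner1970, Thm. 5] [cite: CremonaAlgorithms1997, Table 1 (99)] -/
theorem lFunction_two_five_ne_ghost {W : WeierstrassCurve ℚ} [W.IsElliptic] (D : ModularParametrizationData W 99) :
    ¬ (W.LFunction 2 = -2 ∧ W.LFunction 5 = 1) ∧ ¬ (W.LFunction 2 = 1 ∧ W.LFunction 5 = -2) := by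
  obtain ⟨S, hS, c, hc, htruth, hpin⟩ := pinning_cusp D
  rw [stages_map_fst] at htruth
  rw [certs_eq_rows] at hc
  simp only [List.mem_cons, List.mem_nil_iff, or_false] at hc
  rcases hc with rfl | rfl | rfl | rfl | rfl | rfl
  · exact (no_datum_of_old_row S hS D rowO11.2.2 rfl rfl rfl rfl hpin).elim
  · have h2 := lFunction_two_of_truth rowA htruth
    have h5 := lFunction_five_of_truth rowA htruth
    simp only [rowA, List.getD_cons_succ, List.getD_cons_zero] at h2 h5
    omega
  · have h2 := lFunction_two_of_truth rowB htruth
    have h5 := lFunction_five_of_truth rowB htruth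
    simp only [rowB, List.getD_cons_succ, List.getD_cons_zero] at h2 h5
    omega
  · exact (no_datum_of_old_row S hS D rowO33.2.2 rfl rfl rfl rfl hpin).elim
  · have h2 := lFunction_two_of_truth rowC htruth
    have h5 := lFunction_five_of_truth rowC htruth
    simp only [rowC, List.getD_cons_succ, List.getD_cons_zero] at h2 h5
    omega
  · have h2 := lFunction_two_of_truth rowD htruth
    have h5 := lFunction_five_of_truth rowD htruth
    simp only [rowD, List.getD_cons_succ, List.getD_cons_zero] at h2 h5
    omega

end Summit.BirchSwinnertonDyer.BirchSwinnertonDyer.Theorems.ManinLocalTwoThree.LevelNinetyNine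

end
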